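import Mathlib
import Summits.Ventures.PercRepro2.RowC1OHNFresh

/-!
# The attraction sign of (★): `P(b ∈ K₂ | o ∈ H) ≥ P(b ∈ K₂ | o rootless)` (blind cell PercRepro2, p2 g32;
proofs/P2-G32-STAR.md §7)

With `Q = {a₁ ↮ a₂}`, `oH = {o ↔ a₂}`, `oN = {o ∉ C(a₁) ∪ C(a₂)}` and `K₂ = C_{G−o}(a₂)`:

  **`condK2_oH_ge_oN`: `P(Q, oH) · P(Q, oN, b ∈ K₂) ≤ P(Q, oH, b ∈ K₂) · P(Q, oN)`.**

Proof. Explore the cluster `W = C(a₁)` on `{a₁ ↮ {a₂, o}}`; the events `{o ∈ C(a₂)}` and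
`{b ∈ C_{G−o}(a₂)}` are decided in the fresh graph `G ∖ W` (`RowC1OHNFresh.lean`).  In `G ∖ W` the two
events are increasing, so Harris gives `κ₁ ≥ g π` and `κ₀ ≤ (1 − g) π` with `g = P_{G∖W}(o ∈ C(a₂))`,
`π = P_{G∖W}(b ∈ C_{G−o}(a₂))`, both antitone in `W`; the claim then reduces to
`E[g π 1_R]·E[1_R] ≥ E[g 1_R]·E[π 1_R]`, the functional BHK inequality `bhk_induced` for the
cluster of `a₁` with the avoidance set `{a₂, o}` and the monotone functionals `1 − g`, `1 − π`.
Std axioms.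
-/

namespace Summit.Ventures.PercRepro2

namespace RowC1

section OHN

open Classical

variable {V : Type*} {E : Type*} [Fintype E] [DecidableEq E] [Fintype V] [DecidableEq V]
  {R : Type*} [CommRing R] [LinearOrder R] [IsStrictOrderedRing R]

/-! ### The avoidance indicator `1[o ∉ C(a₁)]·1_Q` and the BHK step -/

/-- `I(ω) = 1[o ∉ C(a₁)]·1[a₁ ↮ a₂]`: the indicator of `{a₁ ↮ a₂, a₁ ↮ o}`. -/
noncomputable def avoidIndA (ends : E → Sym2 V) (a₁ a₂ o : V) (ω : Config E) : R :=
  ({C : Set V | o ∉ C}).indicator 1 (cluster ends ω a₁) * ((connEvent ends a₁ a₂)ᶜ).indicator 1 ω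

omit [Fintype E] [DecidableEq E] [Fintype V] [DecidableEq V] in
/-- `0 ≤ I`. -/
lemma avoidIndA_nonneg (ends : E → Sym2 V) (a₁ a₂ o : V) (ω : Config E) :
    (0 : R) ≤ avoidIndA ends a₁ a₂ o ω :=
  mul_nonneg (Set.indicator_apply_nonneg fun _ => zero_le_one)
    (Set.indicator_apply_nonneg fun _ => zero_le_one)

omit [Fintype E] [DecidableEq E] [LinearOrder R] [IsStrictOrderedRing R] in
/-- `I` is the indicator of `R^{univ}_{{a₂, o}}` for the cluster of `a₁`. -/
lemma REvent_indicator_eq_avoidIndA (ends : E → Sym2 V) (a₁ a₂ o : V) (ω : Config E) :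
    (REvent ends Finset.univ a₁ {a₂, o}).indicator (1 : Config E → R) ω =
      avoidIndA ends a₁ a₂ o ω := by
  unfold avoidIndA
  by_cases h : ω ∈ REvent ends Finset.univ a₁ {a₂, o}
  · rw [Set.indicator_of_mem h, Pi.one_apply]
    have h' : ∀ x ∈ ({a₂, o} : Finset V), ¬ Conn ends ω a₁ x := by
      intro x hx
      have := h x hx
      rwa [Finset.coe_univ, induced_univ] at this
    have hQ : ω ∈ (connEvent ends a₁ a₂)ᶜ := h' a₂ (by simp)
    have hU : cluster ends ω a₁ ∈ {C : Set V | o ∉ C} := h' o (by simp)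
    rw [Set.indicator_of_mem hU, Set.indicator_of_mem hQ]
    simp
  · rw [Set.indicator_of_notMem h]
    by_cases hQ : ω ∈ (connEvent ends a₁ a₂)ᶜ
    · by_cases hU : cluster ends ω a₁ ∈ {C : Set V | o ∉ C}
      · exfalso
        apply h
        intro x hx
        rw [Finset.coe_univ, induced_univ]
        simp only [Finset.mem_insert, Finset.mem_singleton] at hx
        rcases hx with rfl | rfl
        · exact hQ
        · exact hU
      · rw [Set.indicator_of_notMem hU, zero_mul]
    · rw [Set.indicator_of_notMem hQ, mul_zero]

/-- **The BHK step**: with `g = P_{G∖W}(o ∈ C(a₂))`, `π = P_{G∖W}(b ∈ C_{G−o}(a₂))` and `I` the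
avoidance indicator, `E[(1 − g) I]·E[(1 − π) I] ≤ E[(1 − g)(1 − π) I]·E[I]`. -/
theorem bhk_oH_step (p : E → R) (hp : IsProbVec p) (ends : E → Sym2 V) (a₁ a₂ o b : V) :
    expect p (fun ω => (1 - delProb p ends (connEvent ends a₂ o) (cluster ends ω a₁)) *
        avoidIndA ends a₁ a₂ o ω) *
      expect p (fun ω => (1 - delProb p ends (K2ev ends a₂ o b) (cluster ends ω a₁)) *
        avoidIndA ends a₁ a₂ o ω) ≤
    expect p (fun ω => (1 - delProb p ends (connEvent ends a₂ o) (cluster ends ω a₁)) *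
        (1 - delProb p ends (K2ev ends a₂ o b) (cluster ends ω a₁)) * avoidIndA ends a₁ a₂ o ω) *
      expect p (fun ω => avoidIndA ends a₁ a₂ o ω) := by
  have hF₁ : Monotone (fun W : Set V => 1 - delProb p ends (connEvent ends a₂ o) W) :=
    fun W W' h => sub_le_sub_left (delProb_oH_anti p hp ends a₂ o h) 1
  have hF₂ : Monotone (fun W : Set V => 1 - delProb p ends (K2ev ends a₂ o b) W) :=
    fun W W' h => sub_le_sub_left (delProb_K2_anti p hp ends a₂ o b h) 1
  have hF₁0 : ∀ W : Set V, 0 ≤ 1 - delProb p ends (connEvent ends a₂ o) W :=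
    fun W => sub_nonneg.2 (delProb_le_one p hp ends _ W)
  have hF₂0 : ∀ W : Set V, 0 ≤ 1 - delProb p ends (K2ev ends a₂ o b) W :=
    fun W => sub_nonneg.2 (delProb_le_one p hp ends _ W)
  have h := bhk_induced p hp ends a₁ hF₁ hF₂ hF₁0 hF₂0 Finset.univ {a₂, o} {a₂, o}
    (Finset.subset_univ _) (Finset.subset_univ _)
  simp only [Finset.inter_self, Finset.union_self] at h
  have e1 : ∀ F : Set V → R, clusterObs ends Finset.univ a₁ F *
      (REvent ends Finset.univ a₁ {a₂, o}).indicator 1 =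
      fun ω => F (cluster ends ω a₁) * avoidIndA ends a₁ a₂ o ω := by
    intro F
    funext ω
    simp only [Pi.mul_apply, clusterObs_apply, clusterIn_univ, REvent_indicator_eq_avoidIndA]
  have e2 : prob p (REvent ends Finset.univ a₁ {a₂, o}) =
      expect p (fun ω => avoidIndA ends a₁ a₂ o ω) := by
    rw [prob_eq_expect_indicator]
    unfold expect
    refine Finset.sum_congr rfl fun ω _ => ?_
    rw [REvent_indicator_eq_avoidIndA]
  rw [e1, e1, e1, e2] at h
  simpa only [Pi.mul_apply] using h

/-! ### The theorem -/

/-- **The attraction sign of (★)**: `P(Q, o ∈ H) · P(Q, o rootless, b ∈ K₂) ≤ P(Q, o ∈ H, b ∈ K₂) · P(Q, o rootless)`,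
i.e. `P(b ∈ K₂ | Q, o rootless) ≤ P(b ∈ K₂ | Q, o ∈ H)` (`K₂ = C_{G−o}(a₂)`). -/
theorem condK2_oH_ge_oN (p : E → R) (hp : IsProbVec p) (ends : E → Sym2 V) (a₁ a₂ o b : V) :
    prob p (connEvent ends a₂ o ∩ (connEvent ends a₁ a₂)ᶜ) *
        prob p ((connEvent ends a₁ o ∪ connEvent ends a₂ o)ᶜ ∩ connDelEvent ends {o} b a₂ ∩
          (connEvent ends a₁ a₂)ᶜ) ≤
      prob p (connEvent ends a₂ o ∩ connDelEvent ends {o} b a₂ ∩ (connEvent ends a₁ a₂)ᶜ) *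
        prob p ((connEvent ends a₁ o ∪ connEvent ends a₂ o)ᶜ ∩ (connEvent ends a₁ a₂)ᶜ) := by
  -- fresh-event invariance on `{a₂ ∉ C(a₁)}`
  have hA1 : ∀ ω, a₂ ∉ cluster ends ω a₁ → (ω ∈ connEvent ends a₂ o ∩ K2ev ends a₂ o b ↔
      delConfig ends (cluster ends ω a₁) ω ∈ connEvent ends a₂ o ∩ K2ev ends a₂ o b) := by
    intro ω h
    simp only [Set.mem_inter_iff]
    rw [fresh_oH h, fresh_K2 h]
  have hA2 : ∀ ω, a₂ ∉ cluster ends ω a₁ → (ω ∈ (connEvent ends a₂ o)ᶜ ↔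
      delConfig ends (cluster ends ω a₁) ω ∈ (connEvent ends a₂ o)ᶜ) := by
    intro ω h
    simp only [Set.mem_compl_iff]
    rw [fresh_oH h]
  have hA3 : ∀ ω, a₂ ∉ cluster ends ω a₁ → (ω ∈ connEvent ends a₂ o ↔
      delConfig ends (cluster ends ω a₁) ω ∈ connEvent ends a₂ o) := fun ω h => fresh_oH h
  have hA4 : ∀ ω, a₂ ∉ cluster ends ω a₁ → (ω ∈ (connEvent ends a₂ o)ᶜ ∩ K2ev ends a₂ o b ↔
      delConfig ends (cluster ends ω a₁) ω ∈ (connEvent ends a₂ o)ᶜ ∩ K2ev ends a₂ o b) := by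
    intro ω h
    simp only [Set.mem_inter_iff, Set.mem_compl_iff]
    rw [fresh_oH h, fresh_K2 h]
  rw [ev_oH_K2, ev_oN', ev_oH, ev_oN_K2',
    prob_clusterIn_inter_fresh_eq_expect p ends a₁ a₂ _ _ hA1,
    prob_clusterIn_inter_fresh_eq_expect p ends a₁ a₂ _ _ hA2,
    prob_clusterIn_inter_fresh_eq_expect p ends a₁ a₂ _ _ hA3,
    prob_clusterIn_inter_fresh_eq_expect p ends a₁ a₂ _ _ hA4]
  simp only [delProb_compl]
  set g : Config E → R := fun ω => delProb p ends (connEvent ends a₂ o) (cluster ends ω a₁) with hg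
  set π : Config E → R := fun ω => delProb p ends (K2ev ends a₂ o b) (cluster ends ω a₁) with hπ
  set κ₁ : Config E → R := fun ω =>
    delProb p ends (connEvent ends a₂ o ∩ K2ev ends a₂ o b) (cluster ends ω a₁) with hκ₁
  set κ₀ : Config E → R := fun ω =>
    delProb p ends ((connEvent ends a₂ o)ᶜ ∩ K2ev ends a₂ o b) (cluster ends ω a₁) with hκ₀
  set I : Config E → R := fun ω => avoidIndA ends a₁ a₂ o ω with hI
  have r1 : (fun ω => ({C : Set V | o ∉ C}).indicator 1 (cluster ends ω a₁) * κ₁ ω *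
      ((connEvent ends a₁ a₂)ᶜ).indicator 1 ω) = fun ω => κ₁ ω * I ω := by
    funext ω; simp only [hκ₁, hI, avoidIndA]; ring
  have r2 : (fun ω => ({C : Set V | o ∉ C}).indicator 1 (cluster ends ω a₁) * (1 - g ω) *
      ((connEvent ends a₁ a₂)ᶜ).indicator 1 ω) = fun ω => (1 - g ω) * I ω := by
    funext ω; simp only [hg, hI, avoidIndA]; ring
  have r3 : (fun ω => ({C : Set V | o ∉ C}).indicator 1 (cluster ends ω a₁) * g ω *
      ((connEvent ends a₁ a₂)ᶜ).indicator 1 ω) = fun ω => g ω * I ω := by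
    funext ω; simp only [hg, hI, avoidIndA]; ring
  have r4 : (fun ω => ({C : Set V | o ∉ C}).indicator 1 (cluster ends ω a₁) * κ₀ ω *
      ((connEvent ends a₁ a₂)ᶜ).indicator 1 ω) = fun ω => κ₀ ω * I ω := by
    funext ω; simp only [hκ₀, hI, avoidIndA]; ring
  rw [r1, r2, r3, r4]
  -- pointwise facts
  have hI0 : ∀ ω, 0 ≤ I ω := fun ω => avoidIndA_nonneg ends a₁ a₂ o ω
  have hg0 : ∀ ω, 0 ≤ g ω := fun ω => delProb_nonneg p hp ends _ _
  have hg1 : ∀ ω, g ω ≤ 1 := fun ω => delProb_le_one p hp ends _ _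
  have hπ0 : ∀ ω, 0 ≤ π ω := fun ω => delProb_nonneg p hp ends _ _
  have hπ1 : ∀ ω, π ω ≤ 1 := fun ω => delProb_le_one p hp ends _ _
  have hsum : ∀ ω, κ₁ ω + κ₀ ω = π ω := fun ω =>
    delProb_inter_compl_add p ends (connEvent ends a₂ o) (K2ev ends a₂ o b) (cluster ends ω a₁)
  have hharris : ∀ ω, g ω * π ω ≤ κ₁ ω := fun ω =>
    delProb_mul_le p hp ends (isUpperSet_connEvent ends a₂ o) (isUpperSet_K2ev ends a₂ o b) _
  -- the two bounds
  have hB1 : expect p (fun ω => g ω * π ω * I ω) ≤ expect p (fun ω => κ₁ ω * I ω) :=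
    expect_mono hp fun ω => mul_le_mul_of_nonneg_right (hharris ω) (hI0 ω)
  have hB0 : expect p (fun ω => κ₀ ω * I ω) ≤ expect p (fun ω => (1 - g ω) * π ω * I ω) :=
    expect_mono hp fun ω => by
      have := hharris ω; have := hsum ω
      nlinarith [hI0 ω]
  -- nonnegativity
  have n1 : 0 ≤ expect p (fun ω => g ω * I ω) :=
    expect_nonneg hp fun ω => mul_nonneg (hg0 ω) (hI0 ω)
  have n2 : 0 ≤ expect p (fun ω => (1 - g ω) * I ω) :=
    expect_nonneg hp fun ω => mul_nonneg (sub_nonneg.2 (hg1 ω)) (hI0 ω)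
  -- the BHK step and the expansions
  have key := bhk_oH_step p hp ends a₁ a₂ o b
  simp only [← hI] at key
  have x1 : expect p (fun ω => (1 - g ω) * I ω) = expect p I - expect p (fun ω => g ω * I ω) :=
    expect_one_sub_mul p g I
  have x2 : expect p (fun ω => (1 - π ω) * I ω) = expect p I - expect p (fun ω => π ω * I ω) :=
    expect_one_sub_mul p π I
  have x3 : expect p (fun ω => (1 - g ω) * (1 - π ω) * I ω) = expect p I -
      expect p (fun ω => g ω * I ω) - expect p (fun ω => π ω * I ω) +
      expect p (fun ω => g ω * π ω * I ω) := expect_one_sub_mul_one_sub_mul p g π I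
  have x4 : expect p (fun ω => (1 - g ω) * π ω * I ω) =
      expect p (fun ω => π ω * I ω) - expect p (fun ω => g ω * π ω * I ω) :=
    expect_one_sub_mul_mul p g π I
  rw [x1, x2, x3] at key
  rw [x4] at hB0
  rw [x1]
  nlinarith [key, hB1, hB0, n1, n2, mul_le_mul_of_nonneg_left hB0 n1,
    mul_le_mul_of_nonneg_right hB1 n2]

end OHN

end RowC1

end Summit.Ventures.PercRepro2
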